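import Literature.Topology.FourManifolds.ZeroSphereSurgeryModelDiscs
import HarnessLib

/-!
# The local model of the `0`-surgery along a framed `S⁰`, IV: the model read in the chart
# ball, the neck profiles, and the connected-sum disc of `S² × S¹`

Topic `Literature/Topology/FourManifolds`.  Fourth file of the proof of *"`0`-surgery along an
orientably framed `S⁰` in a connected `3`-manifold `Z` gives `Z # (S² × S¹)"* (A. Kosinski,
*Differential Manifolds* (1993), VI §9 with VI (3.1), (6.6); J. Milnor, *Lectures on the
h-cobordism theorem* (1965), Def. 3.11, Thm. 3.13).  Pure theorems about the definitions of
`ZeroSphereSurgeryModelGluing.lean`: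

* §F the odd profile `omegaProfile` (smooth, strictly increasing onto `(-1, 1)`, positive
  derivative) and the radius profile `lamProfile t = 1/(4 (2 - ω t))` of the separating neck
  (smooth, strictly increasing onto `(1/12, 1/4)`, positive derivative, `Λ 0 = 1/8`); the two
  identities that make the neck match the two connected-sum discs —
  `punctureExpansion_half_ballContraction` (the `Z`-side: `η (g(tθ)/2) = Λ t • θ`) and
  `modelK_lamProfile_neg` (the `S² × S¹`-side: `K (Λ (-t) θ) = c₂ (t θ)`); and
  `isSmoothEmbedding_discC2`: `c₂ = H ∘ (q + g/2)` is a smooth embedding of `ℝ³` with open range;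
* §G **`isOpenGluingWith_chartModel`**: the punctured `S² × S¹` is the open gluing of the chart
  ball minus the two disc centres (`chartPieceY`) and the neck along Milnor's relation
  `stdRel discNear discFar` for the two standard discs, by `K = H ∘ M ∘ β̂` and the neck map —
  the model gluing `isOpenGluingWith_model` transported along `y ↦ M (β̂ y)`.

Everything here is proved; no definitions and no named facts are introduced.

## References

* A. A. Kosinski, *Differential Manifolds*, Academic Press (1993), VI §9. [Kosinski1993]
* J. Milnor, *Lectures on the h-cobordism theorem* (1965), Def. 3.11. [MilnorHCobordism1965]
-/

open scoped Manifold ContDiff Topology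
open Set Function Metric

noncomputable section

namespace Literature.Topology.FourManifolds

namespace ZeroSphereModel

/-! ### §F The neck profiles `ω` and `Λ` -/

/-- `ω t = t/32` on `[-8, 8]`. [folklore] -/
theorem omegaProfile_of_abs_le {t : ℝ} (h : |t| ≤ 8) : omegaProfile t = t / 32 := by
  rw [abs_le] at h
  unfold omegaProfile
  split_ifs with ht
  · exact ballProfile_of_le h.2
  · rw [ballProfile_of_le (by linarith)]; ring

/-- `ω t = ballProfile t` for `t ≥ 0`. [folklore] -/
theorem omegaProfile_of_nonneg {t : ℝ} (h : 0 ≤ t) : omegaProfile t = ballProfile t := by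
  simp [omegaProfile, h]

/-- `ω t = -ballProfile (-t)` for `t ≤ 0`. [folklore] -/
theorem omegaProfile_of_nonpos {t : ℝ} (h : t ≤ 0) : omegaProfile t = -ballProfile (-t) := by
  rcases h.lt_or_eq with h' | rfl
  · simp [omegaProfile, not_le.2 h']
  · simp [omegaProfile, ballProfile_zero]

/-- `ω` is odd. [folklore] -/
theorem omegaProfile_neg (t : ℝ) : omegaProfile (-t) = -omegaProfile t := by
  rcases le_total 0 t with h | h
  · rw [omegaProfile_of_nonpos (neg_nonpos.2 h), neg_neg, omegaProfile_of_nonneg h]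
  · rw [omegaProfile_of_nonneg (neg_nonneg.2 h), omegaProfile_of_nonpos h, neg_neg]

/-- `ω 0 = 0`. [folklore] -/
@[simp] theorem omegaProfile_zero : omegaProfile 0 = 0 := by
  rw [omegaProfile_of_nonneg le_rfl, ballProfile_zero]

/-- `|ω t| < 1`. [folklore] -/
theorem abs_omegaProfile_lt (t : ℝ) : |omegaProfile t| < 1 := by
  rcases lt_trichotomy t 0 with h | rfl | h
  · rw [omegaProfile_of_nonpos h.le, abs_neg, abs_of_pos (ballProfile_pos (by linarith))]
    exact ballProfile_lt_one (by linarith)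
  · simp
  · rw [omegaProfile_of_nonneg h.le, abs_of_pos (ballProfile_pos h)]
    exact ballProfile_lt_one h

/-- `ω` is strictly increasing. [folklore] -/
theorem strictMono_omegaProfile : StrictMono omegaProfile := by
  refine StrictMonoOn.Iic_union_Ici (a := 0) (fun a ha b hb hab => ?_) (fun a ha b hb hab => ?_)
  · rw [omegaProfile_of_nonpos ha, omegaProfile_of_nonpos hb, neg_lt_neg_iff]
    exact strictMono_ballProfile (by linarith)
  · rw [omegaProfile_of_nonneg ha, omegaProfile_of_nonneg hb]
    exact strictMono_ballProfile hab

/-- `ω` maps `ℝ` onto `(-1, 1)`. [folklore] -/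
theorem exists_omegaProfile_eq {s : ℝ} (hs : |s| < 1) : ∃ t, omegaProfile t = s := by
  rcases lt_trichotomy s 0 with h | rfl | h
  · obtain ⟨ρ, hρ, hρs⟩ := exists_ballProfile_eq (s := -s) ⟨by linarith, by linarith [(abs_lt.1 hs).1]⟩
    exact ⟨-ρ, by rw [omegaProfile_of_nonpos (by linarith), neg_neg, hρs, neg_neg]⟩
  · exact ⟨0, omegaProfile_zero⟩
  · obtain ⟨ρ, hρ, hρs⟩ := exists_ballProfile_eq (s := s) ⟨h, (abs_lt.1 hs).2⟩
    exact ⟨ρ, by rw [omegaProfile_of_nonneg hρ.le, hρs]⟩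

/-- `ω` is smooth. [folklore] -/
theorem contDiff_omegaProfile : ContDiff ℝ ∞ omegaProfile := by
  rw [contDiff_iff_contDiffAt]
  intro t
  rcases lt_trichotomy t 0 with h | rfl | h
  · have hev : omegaProfile =ᶠ[𝓝 t] fun t => -ballProfile (-t) :=
      Filter.eventuallyEq_of_mem (Iio_mem_nhds h) fun x hx => omegaProfile_of_nonpos (le_of_lt hx)
    refine (ContDiffAt.congr_of_eventuallyEq ?_ hev)
    exact ((contDiffAt_ballProfile (by linarith : -t ≠ 0)).comp t contDiff_neg.contDiffAt).neg
  · have hev : omegaProfile =ᶠ[𝓝 (0:ℝ)] fun t => t / 32 :=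
      Filter.eventuallyEq_of_mem (Ioo_mem_nhds (by norm_num : (-8:ℝ) < 0) (by norm_num : (0:ℝ) < 8))
        fun x hx => omegaProfile_of_abs_le (abs_le.2 ⟨hx.1.le, hx.2.le⟩)
    exact (contDiffAt_id.div_const _).congr_of_eventuallyEq hev
  · have hev : omegaProfile =ᶠ[𝓝 t] ballProfile :=
      Filter.eventuallyEq_of_mem (Ioi_mem_nhds h) fun x hx => omegaProfile_of_nonneg (le_of_lt hx)
    exact (contDiffAt_ballProfile h.ne').congr_of_eventuallyEq hev

/-- The derivative of `ω` is positive. [folklore] -/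
theorem deriv_omegaProfile_pos (t : ℝ) : 0 < deriv omegaProfile t := by
  rcases lt_trichotomy t 0 with h | rfl | h
  · have hev : omegaProfile =ᶠ[𝓝 t] fun t => -ballProfile (-t) :=
      Filter.eventuallyEq_of_mem (Iio_mem_nhds h) fun x hx => omegaProfile_of_nonpos (le_of_lt hx)
    rw [hev.deriv_eq]
    have hd : HasDerivAt (fun t => -ballProfile (-t)) (deriv ballProfile (-t)) t := by
      have h1 := ((hasDerivAt_ballProfile (by linarith : -t ≠ 0)).comp t (hasDerivAt_neg t)).neg
      refine h1.congr_deriv ?_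
      rw [(hasDerivAt_ballProfile (by linarith : -t ≠ 0)).deriv]; ring
    rw [hd.deriv]
    exact deriv_ballProfile_pos' (by linarith)
  · have hev : omegaProfile =ᶠ[𝓝 (0:ℝ)] fun t => t / 32 :=
      Filter.eventuallyEq_of_mem (Ioo_mem_nhds (by norm_num : (-8:ℝ) < 0) (by norm_num : (0:ℝ) < 8))
        fun x hx => omegaProfile_of_abs_le (abs_le.2 ⟨hx.1.le, hx.2.le⟩)
    rw [hev.deriv_eq]
    have : deriv (fun t : ℝ => t / 32) 0 = 1 / 32 := by
      rw [show (fun t : ℝ => t / 32) = fun t => (1 / 32) * t by funext t; ring]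
      simp
    rw [this]; norm_num
  · have hev : omegaProfile =ᶠ[𝓝 t] ballProfile :=
      Filter.eventuallyEq_of_mem (Ioi_mem_nhds h) fun x hx => omegaProfile_of_nonneg (le_of_lt hx)
    rw [hev.deriv_eq]
    exact deriv_ballProfile_pos' h

/-- `2 - ω t > 1`. [folklore] -/
theorem one_lt_two_sub_omegaProfile (t : ℝ) : 1 < 2 - omegaProfile t := by
  linarith [(abs_lt.1 (abs_omegaProfile_lt t)).2]

/-- `Λ t = 1/(4 (2 - ω t))` is smooth. [folklore] -/
theorem contDiff_lamProfile : ContDiff ℝ ∞ lamProfile :=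
  contDiff_const.div (contDiff_const.mul (contDiff_const.sub contDiff_omegaProfile)) fun t => by
    linarith [one_lt_two_sub_omegaProfile t]

/-- `1/12 < Λ t`. [folklore] -/
theorem lamProfile_gt (t : ℝ) : 1 / 12 < lamProfile t := by
  have := (abs_lt.1 (abs_omegaProfile_lt t)).1
  rw [lamProfile, div_lt_div_iff₀ (by norm_num) (by linarith [one_lt_two_sub_omegaProfile t])]
  linarith

/-- `Λ t < 1/4`. [folklore] -/
theorem lamProfile_lt (t : ℝ) : lamProfile t < 1 / 4 := by
  have h1 := one_lt_two_sub_omegaProfile t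
  rw [lamProfile, div_lt_div_iff₀ (by linarith) (by norm_num)]
  linarith

/-- `Λ t > 0`. [folklore] -/
theorem lamProfile_pos (t : ℝ) : 0 < lamProfile t := lt_trans (by norm_num) (lamProfile_gt t)

/-- `Λ 0 = 1/8`. [folklore] -/
@[simp] theorem lamProfile_zero : lamProfile 0 = 1 / 8 := by
  rw [lamProfile, omegaProfile_zero]; norm_num

/-- `Λ` is strictly increasing. [folklore] -/
theorem strictMono_lamProfile : StrictMono lamProfile := fun a b hab => by
  have ha := one_lt_two_sub_omegaProfile a
  have hb := one_lt_two_sub_omegaProfile b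
  have h := strictMono_omegaProfile hab
  rw [lamProfile, lamProfile, div_lt_div_iff₀ (by linarith) (by linarith)]
  nlinarith

/-- `Λ` is injective. [folklore] -/
theorem lamProfile_injective : Injective lamProfile := strictMono_lamProfile.injective

/-- `1/8 < Λ t ↔ 0 < t` (the upper half-neck lies outside the middle sphere). [folklore] -/
theorem lamProfile_gt_iff {t : ℝ} : 1 / 8 < lamProfile t ↔ 0 < t := by
  rw [← lamProfile_zero]; exact strictMono_lamProfile.lt_iff_lt

/-- `Λ t < 1/8 ↔ t < 0`. [folklore] -/
theorem lamProfile_lt_iff {t : ℝ} : lamProfile t < 1 / 8 ↔ t < 0 := by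
  rw [← lamProfile_zero]; exact strictMono_lamProfile.lt_iff_lt

/-- `Λ` maps `ℝ` onto `(1/12, 1/4)`. [folklore] -/
theorem exists_lamProfile_eq {r : ℝ} (h1 : 1 / 12 < r) (h2 : r < 1 / 4) : ∃ t, lamProfile t = r := by
  -- solve `1/(4(2 - s)) = r`, `s = 2 - 1/(4 r)`
  have hr : 0 < r := by linarith
  have hs : |2 - 1 / (4 * r)| < 1 := by
    rw [abs_lt]; constructor
    · rw [show (2:ℝ) - 1 / (4 * r) = (8 * r - 1) / (4 * r) by field_simp; ring,
        lt_div_iff₀ (by positivity)]; nlinarith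
    · rw [show (2:ℝ) - 1 / (4 * r) = (8 * r - 1) / (4 * r) by field_simp; ring,
        div_lt_iff₀ (by positivity)]; nlinarith
  obtain ⟨t, ht⟩ := exists_omegaProfile_eq hs
  refine ⟨t, ?_⟩
  rw [lamProfile, ht]
  field_simp
  ring

/-- The derivative of `Λ` is positive. [folklore] -/
theorem deriv_lamProfile_pos (t : ℝ) : 0 < deriv lamProfile t := by
  have h2 := one_lt_two_sub_omegaProfile t
  have hω : HasDerivAt omegaProfile (deriv omegaProfile t) t :=
    (contDiff_omegaProfile.differentiable (by simp) t).hasDerivAt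
  have hd : HasDerivAt lamProfile (deriv omegaProfile t / (4 * (2 - omegaProfile t) ^ 2)) t := by
    have h1 : HasDerivAt (fun t => 4 * (2 - omegaProfile t)) (4 * (0 - deriv omegaProfile t)) t :=
      ((hasDerivAt_const t (2:ℝ)).sub hω).const_mul 4
    have h3 := (hasDerivAt_const t (1:ℝ)).div h1 (by positivity)
    refine h3.congr_deriv ?_
    field_simp
    ring
  rw [hd.deriv]
  exact div_pos (deriv_omegaProfile_pos t) (by positivity)

/-- **The `Z`-side identity**: the puncture expansion of `g(t θ)/2` is the neck point
`Λ t • θ` (`t > 0`, `θ ∈ S²`): `η (ψ_b t / 2) = 1/(8 (1 - ψ_b t/2)) = Λ t`. [folklore] -/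
theorem punctureExpansion_half_ballContraction (θ : Metric.sphere (0 : EuclideanSpace ℝ (Fin 3)) 1) {t : ℝ} (ht : 0 < t) :
    punctureExpansion ((2 : ℝ)⁻¹ • ballContraction (t • (θ : EuclideanSpace ℝ (Fin 3)))) =
      lamProfile t • (θ : EuclideanSpace ℝ (Fin 3)) := by
  have hθ : ‖(θ : EuclideanSpace ℝ (Fin 3))‖ = 1 := norm_eq_of_mem_sphere θ
  have hb := ballProfile_mem_Ioo ht
  rw [ballContraction_smul hθ ht, smul_smul, punctureExpansion_smul hθ (by nlinarith [hb.1]),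
    punctureProfile_of_pos_of_le_half (by nlinarith [hb.2]), lamProfile, omegaProfile_of_nonneg ht.le]
  congr 1
  have : (1 : ℝ) - 2⁻¹ * ballProfile t ≠ 0 := by nlinarith [hb.2]
  field_simp
  ring

/-- The chart radius `Λ (-t)` of the lower half-neck, `t > 0`: `1/(4 (2 + ψ_b t))`. [folklore] -/
theorem lamProfile_neg {t : ℝ} (ht : 0 < t) : lamProfile (-t) = 1 / (4 * (2 + ballProfile t)) := by
  rw [lamProfile, omegaProfile_neg, omegaProfile_of_nonneg ht.le, sub_neg_eq_add]

/-- **The `S² × S¹`-side identity**: `K (Λ (-t) • θ) = c₂ (t • θ)` for `t > 0`, `θ ∈ S²` —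
blowing up the lower half-neck point of chart radius `1/(4 (2 + ψ))` gives `(2/ψ) θ`, whose
Möbius image is `q + (ψ/2) θ = q + g(t θ)/2` (`ψ = ψ_b t`). [folklore] -/
theorem modelK_lamProfile_neg (θ : Metric.sphere (0 : EuclideanSpace ℝ (Fin 3)) 1) {t : ℝ} (ht : 0 < t) :
    modelK (lamProfile (-t) • (θ : EuclideanSpace ℝ (Fin 3))) = discC2 (t • (θ : EuclideanSpace ℝ (Fin 3))) := by
  have hθ : ‖(θ : EuclideanSpace ℝ (Fin 3))‖ = 1 := norm_eq_of_mem_sphere θ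
  have hb := ballProfile_mem_Ioo ht
  set ψ := ballProfile t with hψ
  have hr : lamProfile (-t) = 1 / (4 * (2 + ψ)) := lamProfile_neg ht
  have hrpos : 0 < lamProfile (-t) := lamProfile_pos _
  have hnorm : ‖lamProfile (-t) • (θ : EuclideanSpace ℝ (Fin 3))‖ = lamProfile (-t) := by
    rw [norm_smul, hθ, mul_one, Real.norm_of_nonneg hrpos.le]
  have h22 : 1 / 22 ≤ lamProfile (-t) := by rw [hr, div_le_div_iff₀ (by norm_num) (by nlinarith [hb.1])]; nlinarith [hb.2]
  have h8 : lamProfile (-t) < 1 / 8 := lamProfile_lt_iff.2 (by linarith)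
  -- blow up
  have hblow : blowUp (lamProfile (-t) • (θ : EuclideanSpace ℝ (Fin 3))) = (2 / ψ) • (θ : EuclideanSpace ℝ (Fin 3)) := by
    rw [blowUp_of_ge (by rwa [hnorm]) (by rwa [hnorm]), hnorm, smul_smul, hr]
    congr 1
    have h1 : (2 : ℝ) + ψ ≠ 0 := by nlinarith [hb.1]
    have h2 : ψ ≠ 0 := hb.1.ne'
    have h3 : (1 : ℝ) - 8 * (1 / (4 * (2 + ψ))) = ψ / (2 + ψ) := by field_simp; ring
    rw [h3, div_div_eq_mul_div]
    field_simp
    norm_num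
  -- Möbius
  have hM : mobM ((2 / ψ) • (θ : EuclideanSpace ℝ (Fin 3))) = qPt + (ψ / 2) • (θ : EuclideanSpace ℝ (Fin 3)) := by
    have h2 : ψ ≠ 0 := hb.1.ne'
    rw [mobM, norm_smul, hθ, mul_one, Real.norm_of_nonneg (div_nonneg (by norm_num) hb.1.le), smul_smul]
    congr 2
    field_simp
  rw [modelK, hblow, hM, discC2, ballContraction_smul hθ ht, smul_smul]
  congr 3
  ring

/-- `c₂ 0` is the removed point `H q`. [folklore] -/
@[simp] theorem discC2_zero : discC2 0 = modelPoint := by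
  simp [discC2, ballContraction_zero, modelPoint]

/-- The argument `q + g y/2` of `H` in `c₂` is nonzero. [folklore] -/
theorem qPt_add_half_ballContraction_ne_zero (y : EuclideanSpace ℝ (Fin 3)) : qPt + (2 : ℝ)⁻¹ • ballContraction y ≠ 0 := by
  intro h
  have h1 : ‖(2 : ℝ)⁻¹ • ballContraction y‖ < 1 / 2 := by
    rw [norm_smul, norm_inv, Real.norm_of_nonneg (by norm_num : (0:ℝ) ≤ 2)]
    linarith [norm_ballContraction_lt_one y]
  have h2 : ‖qPt‖ = ‖(2 : ℝ)⁻¹ • ballContraction y‖ := by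
    rw [← norm_neg ((2 : ℝ)⁻¹ • ballContraction y), show -((2 : ℝ)⁻¹ • ballContraction y) = qPt from by
      rw [eq_comm, eq_neg_iff_add_eq_zero, h]]
  rw [norm_qPt] at h2
  linarith

/-- `H⁻¹ (c₂ y) = q + g y/2`. [folklore] -/
theorem modelHInv_discC2 (y : EuclideanSpace ℝ (Fin 3)) : modelHInv (discC2 y) = qPt + (2 : ℝ)⁻¹ • ballContraction y :=
  modelHInv_modelHFun (qPt_add_half_ballContraction_ne_zero y)

/-- **`c₂` is a smooth embedding of `ℝ³` into `S² × S¹`** (a globally defined partial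
diffeomorphism onto `H (B(q, 1/2) )`, inverse `w ↦ g⁻¹ (2 (H⁻¹ w - q))`). [folklore] -/
theorem isSmoothEmbedding_discC2 :
    Manifold.IsSmoothEmbedding 𝓘(ℝ, EuclideanSpace ℝ (Fin 3)) ((𝓡 2).prod (𝓡 1)) ∞ discC2 ∧ IsOpen (range discC2) := by
  haveI : Fact (Module.finrank ℝ (EuclideanSpace ℝ (Fin 2)) = 1 + 1) := ⟨by simp⟩
  haveI : Fact (Module.finrank ℝ (EuclideanSpace ℝ (Fin 3)) = 2 + 1) := ⟨by simp⟩
  have hcont : ContinuousOn modelHInv {w : (Metric.sphere (0 : EuclideanSpace ℝ (Fin 3)) 1) ×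
      (Metric.sphere (0 : EuclideanSpace ℝ (Fin 2)) 1) | (w.2 : EuclideanSpace ℝ (Fin 2)) 0 ≠ 1} :=
    contMDiffOn_modelHInv.continuousOn
  let Φ : OpenPartialHomeomorph (EuclideanSpace ℝ (Fin 3)) ((Metric.sphere (0 : EuclideanSpace ℝ (Fin 3)) 1) ×
      (Metric.sphere (0 : EuclideanSpace ℝ (Fin 2)) 1)) :=
    { toFun := discC2
      invFun := fun w => ballContractionInv ((2 : ℝ) • (modelHInv w - qPt))
      source := univ
      target := {w | (w.2 : EuclideanSpace ℝ (Fin 2)) 0 ≠ 1 ∧ ‖modelHInv w - qPt‖ < 1 / 2}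
      map_source' := fun y _ => by
        refine ⟨modelHFun_snd_apply_zero_ne_one _, ?_⟩
        rw [modelHInv_discC2, add_sub_cancel_left, norm_smul, norm_inv, Real.norm_of_nonneg (by norm_num : (0:ℝ) ≤ 2)]
        linarith [norm_ballContraction_lt_one y]
      map_target' := fun _ _ => mem_univ _
      left_inv' := fun y _ => by
        show ballContractionInv ((2 : ℝ) • (modelHInv (discC2 y) - qPt)) = y
        rw [modelHInv_discC2, add_sub_cancel_left, smul_inv_smul₀ (by norm_num : (2:ℝ) ≠ 0),
          ballContractionInv_ballContraction]
      right_inv' := fun w hw => by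
        have h1 : ‖(2 : ℝ) • (modelHInv w - qPt)‖ < 1 := by
          rw [norm_smul, Real.norm_of_nonneg (by norm_num : (0:ℝ) ≤ 2)]; linarith [hw.2]
        show discC2 (ballContractionInv ((2 : ℝ) • (modelHInv w - qPt))) = w
        rw [discC2, ballContraction_ballContractionInv h1, inv_smul_smul₀ (by norm_num : (2:ℝ) ≠ 0),
          add_sub_cancel, modelHFun_modelHInv hw.1]
      open_source := isOpen_univ
      open_target := by
        have h := hcont.isOpen_inter_preimage isOpen_snd_ne_pole
          ((Metric.isOpen_ball (x := qPt) (ε := 1 / 2)))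
        convert h using 1
        ext w
        simp only [mem_setOf_eq, mem_inter_iff, mem_preimage, Metric.mem_ball, dist_eq_norm]
      continuousOn_toFun := by
        refine Continuous.continuousOn ?_
        exact contMDiffOn_modelHFun.continuousOn.comp_continuous
          (continuous_const.add ((continuous_const_smul (2:ℝ)⁻¹).comp continuous_ballContraction)) fun y =>
            qPt_add_half_ballContraction_ne_zero y
      continuousOn_invFun := by
        refine contDiffOn_ballContractionInv.continuousOn.comp ((continuous_const_smul (2:ℝ)).comp_continuousOn
          ((hcont.mono fun w hw => hw.1).sub continuousOn_const)) fun w hw => ?_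
        rw [mem_ball_zero_iff, norm_smul, Real.norm_of_nonneg (by norm_num : (0:ℝ) ≤ 2)]
        linarith [hw.2] }
  have hΦ : ContMDiffOn 𝓘(ℝ, EuclideanSpace ℝ (Fin 3)) ((𝓡 2).prod (𝓡 1)) ∞ Φ Φ.source := by
    show ContMDiffOn 𝓘(ℝ, EuclideanSpace ℝ (Fin 3)) ((𝓡 2).prod (𝓡 1)) ∞ discC2 univ
    exact contMDiffOn_modelHFun.comp (contDiff_const.add (contDiff_ballContraction.const_smul _)).contMDiff.contMDiffOn
      fun y _ => qPt_add_half_ballContraction_ne_zero y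
  have hΦ' : ContMDiffOn ((𝓡 2).prod (𝓡 1)) 𝓘(ℝ, EuclideanSpace ℝ (Fin 3)) ∞ Φ.symm Φ.target := by
    show ContMDiffOn ((𝓡 2).prod (𝓡 1)) 𝓘(ℝ, EuclideanSpace ℝ (Fin 3)) ∞
      (fun w => ballContractionInv ((2 : ℝ) • (modelHInv w - qPt)))
      {w | (w.2 : EuclideanSpace ℝ (Fin 2)) 0 ≠ 1 ∧ ‖modelHInv w - qPt‖ < 1 / 2}
    have h0 : ContMDiffOn ((𝓡 2).prod (𝓡 1)) 𝓘(ℝ, EuclideanSpace ℝ (Fin 3)) ∞ modelHInv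
        {w | (w.2 : EuclideanSpace ℝ (Fin 2)) 0 ≠ 1 ∧ ‖modelHInv w - qPt‖ < 1 / 2} :=
      contMDiffOn_modelHInv.mono fun w hw => hw.1
    have h1 : ContMDiffOn ((𝓡 2).prod (𝓡 1)) 𝓘(ℝ, EuclideanSpace ℝ (Fin 3)) ∞
        (fun w => (2 : ℝ) • (modelHInv w - qPt))
        {w | (w.2 : EuclideanSpace ℝ (Fin 2)) 0 ≠ 1 ∧ ‖modelHInv w - qPt‖ < 1 / 2} :=
      (contMDiffOn_const : ContMDiffOn ((𝓡 2).prod (𝓡 1)) 𝓘(ℝ, ℝ) ∞ (fun _ => (2 : ℝ))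
        {w : (Metric.sphere (0 : EuclideanSpace ℝ (Fin 3)) 1) × (Metric.sphere (0 : EuclideanSpace ℝ (Fin 2)) 1) |
          (w.2 : EuclideanSpace ℝ (Fin 2)) 0 ≠ 1 ∧ ‖modelHInv w - qPt‖ < 1 / 2}).smul (h0.sub contMDiffOn_const)
    refine contDiffOn_ballContractionInv.contMDiffOn.comp h1 fun w hw => ?_
    rw [mem_preimage, mem_ball_zero_iff, norm_smul, Real.norm_of_nonneg (by norm_num : (0:ℝ) ≤ 2)]
    linarith [hw.2]
  refine ⟨isSmoothEmbedding_of_openPartialHomeomorph Φ rfl hΦ hΦ' (ContinuousLinearEquiv.ofFinrankEq (by simp)), ?_⟩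
  have hr : range discC2 = Φ.target := by
    rw [← Φ.image_source_eq_target, show Φ.source = univ from rfl, image_univ]; rfl
  rw [hr]; exact Φ.open_target

/-! ### §G The model read in the chart ball: `(S² × S¹) ∖ pt` is the chart ball minus the two
disc centres, glued to the neck along Milnor's relation for the standard discs -/

/-- For `y` in the punctured chart ball, `M (β̂ y)` lies in `ℝ³ ∖ {0, q}`. [folklore] -/
theorem mobM_blowUp_mem_pieceA {y : EuclideanSpace ℝ (Fin 3)} (hy : y ∈ chartPieceY) : mobM (blowUp y) ∈ pieceA := by
  obtain ⟨hy8, hy0, hyc⟩ := hy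
  have hb0 : blowUp y ≠ 0 := blowUp_ne_zero hy8 hy0
  refine ⟨fun h => hyc ?_, mobM_ne_qPt hb0⟩
  rw [mobM_eq_zero_iff hb0] at h
  rw [← blowDown_blowUp hy8, h]; rfl

/-- For `x ∈ ℝ³ ∖ {0, q}`, `β̂⁻¹ (N x)` lies in the punctured chart ball. [folklore] -/
theorem blowDown_mobN_mem_chartPieceY {x : EuclideanSpace ℝ (Fin 3)} (hx : x ∈ pieceA) :
    blowDown (mobN x) ∈ chartPieceY := by
  obtain ⟨hx0, hxq⟩ := hx
  refine ⟨norm_blowDown_lt _, blowDown_ne_zero (mobN_ne_zero hxq), fun h => hx0 ?_⟩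
  have h1 : mobN x = nearFootZ := blowDown_injective h
  rw [← mobM_mobN hxq, h1, nearFootZ, mobM_mobN (Ne.symm qPt_ne_zero)]

/-- `K y` lies in the punctured `S² × S¹` for `y` in the punctured chart ball. [folklore] -/
theorem modelK_mem_pieceP {y : EuclideanSpace ℝ (Fin 3)} (hy : y ∈ chartPieceY) : modelK y ∈ pieceP :=
  mapsTo_modelH (mobM_blowUp_mem_pieceA hy)

/-- **Reading a point of the model in the chart**: `y = β̂⁻¹ (N v)` iff `M (β̂ y) = v` (for `y` in
the punctured chart ball and `v ≠ q`). [folklore] -/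
theorem eq_blowDown_mobN_iff {y : EuclideanSpace ℝ (Fin 3)} (hy8 : ‖y‖ < 1 / 8) (hy0 : y ≠ 0)
    {v : EuclideanSpace ℝ (Fin 3)} (hv : v ≠ qPt) : y = blowDown (mobN v) ↔ mobM (blowUp y) = v := by
  constructor
  · rintro rfl
    rw [blowUp_blowDown, mobM_mobN hv]
  · intro h
    have h1 : mobN (mobM (blowUp y)) = blowUp y := mobN_mobM (blowUp_ne_zero hy8 hy0)
    rw [h] at h1
    rw [h1, blowDown_blowUp hy8]

/-- **Milnor's relation for the standard discs is the model relation read in the chart.**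
[cite: MilnorHCobordism1965, Def. 3.11] -/
theorem stdRel_discs_iff_modelRel {y : EuclideanSpace ℝ (Fin 3)} (hy : y ∈ chartPieceY)
    (a : ↥chartPieceY) (ha : (a : EuclideanSpace ℝ (Fin 3)) = y) (b : ↥(ballTimesSphere Unit 0 2)) :
    stdRel discNear discFar a b ↔ modelRel ⟨mobM (blowUp y), mobM_blowUp_mem_pieceA hy⟩ b := by
  subst ha
  obtain ⟨hy8, hy0, -⟩ := hy
  have hu : ‖((b : NeckAmbient).2.2 : EuclideanSpace ℝ (Fin 3))‖ = 1 := norm_eq_of_mem_sphere _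
  have key1 : ∀ {t : ℝ}, t ∈ Ioo (0:ℝ) 1 →
      ((a : EuclideanSpace ℝ (Fin 3)) = discNear (t • ((b : NeckAmbient).2.2 : EuclideanSpace ℝ (Fin 3))) ↔
        mobM (blowUp a) = (t / 4) • ((b : NeckAmbient).2.2 : EuclideanSpace ℝ (Fin 3))) := by
    intro t ht
    have hn : ‖t • ((b : NeckAmbient).2.2 : EuclideanSpace ℝ (Fin 3))‖ ≤ 1 := by
      rw [norm_smul, hu, mul_one, Real.norm_of_nonneg ht.1.le]; exact ht.2.le
    have hv : (t / 4) • ((b : NeckAmbient).2.2 : EuclideanSpace ℝ (Fin 3)) ≠ qPt := by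
      intro h; have := congrArg norm h
      rw [norm_smul, hu, mul_one, norm_qPt, Real.norm_of_nonneg (by linarith [ht.1])] at this; linarith [ht.2]
    rw [discNear_of_norm_le hn, smul_smul, show (4 : ℝ)⁻¹ * t = t / 4 by ring]
    exact eq_blowDown_mobN_iff hy8 hy0 hv
  have key2 : ∀ {t : ℝ}, t ∈ Ioo (0:ℝ) 1 →
      ((a : EuclideanSpace ℝ (Fin 3)) = discFar (t • ((b : NeckAmbient).2.2 : EuclideanSpace ℝ (Fin 3))) ↔
        mobM (blowUp a) = (8 / t) • ((b : NeckAmbient).2.2 : EuclideanSpace ℝ (Fin 3))) := by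
    intro t ht
    have hnorm : ‖t • ((b : NeckAmbient).2.2 : EuclideanSpace ℝ (Fin 3))‖ = t := by
      rw [norm_smul, hu, mul_one, Real.norm_of_nonneg ht.1.le]
    have hne : t • ((b : NeckAmbient).2.2 : EuclideanSpace ℝ (Fin 3)) ≠ 0 := by
      rw [← norm_pos_iff, hnorm]; exact ht.1
    have hv : (8 / t) • ((b : NeckAmbient).2.2 : EuclideanSpace ℝ (Fin 3)) ≠ qPt := by
      intro h; have := congrArg norm h
      rw [norm_smul, hu, mul_one, norm_qPt, Real.norm_of_nonneg (by have := ht.1; positivity)] at this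
      rw [div_eq_iff ht.1.ne'] at this; nlinarith [ht.2]
    rw [discFar_of_norm_le (by rw [hnorm]; exact ht.2.le), farMob_eq_mobN hne (by rw [hnorm]; linarith [ht.2]),
      hnorm, smul_smul, show 8 / t ^ 2 * t = 8 / t by field_simp]
    exact eq_blowDown_mobN_iff hy8 hy0 hv
  constructor
  · rintro ⟨t, ht, ⟨hb, hq⟩ | ⟨hb, hq⟩⟩
    · exact ⟨t, ht, Or.inl ⟨hb, (key1 ht).1 hq⟩⟩
    · exact ⟨t, ht, Or.inr ⟨hb, (key2 ht).1 hq⟩⟩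
  · rintro ⟨t, ht, ⟨hb, hq⟩ | ⟨hb, hq⟩⟩
    · exact ⟨t, ht, Or.inl ⟨hb, (key1 ht).2 hq⟩⟩
    · exact ⟨t, ht, Or.inr ⟨hb, (key2 ht).2 hq⟩⟩

/-- **The model gluing read in the chart ball.**  The punctured `S² × S¹` is the open gluing of
the chart ball minus the two disc centres (`chartPieceY`) and the neck along Milnor's relation
`stdRel discNear discFar` for the two standard discs, by the maps `K = H ∘ M ∘ β̂` and the neck map
(transport of `isOpenGluingWith_model` along the diffeomorphism `y ↦ M (β̂ y)`).
[cite: MilnorHCobordism1965, Def. 3.11] [cite: Kosinski1993, VI §9] -/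
theorem isOpenGluingWith_chartModel :
    IsOpenGluingWith (𝓡 3) ((𝓡 0).prod ((𝓡 1).prod (𝓡 2))) ((𝓡 2).prod (𝓡 1))
      (A := ↥chartPieceY) (B := ↥(ballTimesSphere Unit 0 2)) (P := ↥pieceP)
      (stdRel discNear discFar) (fun y => ⟨modelK y, modelK_mem_pieceP y.2⟩) glueB := by
  -- the diffeomorphism `y ↦ M (β̂ y)` between the two first pieces
  have hsm1 : ContMDiff (𝓡 3) (𝓡 3) ∞ (fun y : ↥chartPieceY => (⟨mobM (blowUp y), mobM_blowUp_mem_pieceA y.2⟩ : ↥pieceA)) := by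
    refine (ContMDiff.subtypeVal_comp_iff _ _).1 ?_
    have h : ContMDiffOn (𝓡 3) (𝓡 3) ∞ (fun y : EuclideanSpace ℝ (Fin 3) => mobM (blowUp y)) (chartPieceY : Set _) := by
      intro y hy
      exact ((contDiffAt_mobM (blowUp_ne_zero hy.1 hy.2.1)).comp y (contDiffAt_blowUp hy.1)).contMDiffAt.contMDiffWithinAt
    exact h.comp_contMDiff contMDiff_subtype_val fun y => y.2
  have hsm2 : ContMDiff (𝓡 3) (𝓡 3) ∞ (fun x : ↥pieceA => (⟨blowDown (mobN x), blowDown_mobN_mem_chartPieceY x.2⟩ : ↥chartPieceY)) := by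
    refine (ContMDiff.subtypeVal_comp_iff _ _).1 ?_
    have h : ContMDiffOn (𝓡 3) (𝓡 3) ∞ (fun x : EuclideanSpace ℝ (Fin 3) => blowDown (mobN x)) (pieceA : Set _) := by
      intro x hx
      exact (contDiff_blowDown.contDiffAt.comp x (contDiffAt_mobN hx.2)).contMDiffAt.contMDiffWithinAt
    exact h.comp_contMDiff contMDiff_subtype_val fun x => x.2
  let Θ : ↥chartPieceY ≃ₘ⟮𝓡 3, 𝓡 3⟯ ↥pieceA :=
    { toFun := fun y => ⟨mobM (blowUp y), mobM_blowUp_mem_pieceA y.2⟩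
      invFun := fun x => ⟨blowDown (mobN x), blowDown_mobN_mem_chartPieceY x.2⟩
      left_inv := fun y => Subtype.ext (by
        show blowDown (mobN (mobM (blowUp y))) = y
        rw [mobN_mobM (blowUp_ne_zero y.2.1 y.2.2.1), blowDown_blowUp y.2.1])
      right_inv := fun x => Subtype.ext (by
        show mobM (blowUp (blowDown (mobN x))) = x
        rw [blowUp_blowDown, mobM_mobN x.2.2])
      contMDiff_toFun := hsm1
      contMDiff_invFun := hsm2 }
  have hfun : (fun y : ↥chartPieceY => (⟨modelK y, modelK_mem_pieceP y.2⟩ : ↥pieceP)) = glueA ∘ Θ := by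
    funext y; exact Subtype.ext rfl
  obtain ⟨hA, hAo, hB, hBo, hU, hR⟩ := isOpenGluingWith_model
  have hΘs : Surjective Θ := Θ.surjective
  rw [hfun]
  refine ⟨hA.comp_diffeomorph Θ, by rwa [hΘs.range_comp], hB, hBo, by rwa [hΘs.range_comp], fun a b => ?_⟩
  rw [Function.comp_apply, hR, stdRel_discs_iff_modelRel a.2 a rfl b]
  rfl

end ZeroSphereModel

end Literature.Topology.FourManifolds
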